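import Summits.QuantumFields.YangMills.Theorems.UnitScaleTiltProp7HPcolNegPauliExp
import Mathlib.Analysis.CStarAlgebra.Matrix
import Mathlib.Analysis.Normed.Algebra.MatrixExponential
import HarnessLib

/-!
# Route `UnitScaleTilt`, crux «MinimiserStabilityRegPr» (stmt-QuantumFields-19200), stub EX — NEG-hPcol certificate (★★OWNER WORD 38, module token `Neg` per ACK 108), piece (N2b):
# THE GROUP COMMUTATOR OF TWO ONE-AXIS `SU(2)` EXPONENTIALS — `‖[e^{iaσ_μ}, e^{ibσ_ν}] − 1‖ ≤ 2|a||b|` and `[e^{iaσ_μ}, e^{ibσ_ν}] ≠ 1` for `μ ≠ ν`, `sin a, sin b ≠ 0`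

Cell `ym3-torus` (YM ladder rung R3 = continuum SU(2) Yang–Mills on T³ — NOT d = 4, NOT infinite volume, NOT a mass gap, NOT the Clay problem); width seat
`ym3-torus-px9` gen 10; ★★OWNER WORD 38 «NEG-hPcol — GO, LOW PRIORITY», piece (N2b) of px12 g11's naming line (2026-08-29).  THEOREMS ONLY (0 `def`, 0 `sorry`,
default heartbeats); `--supports stmt-QuantumFields-19200 --as helper`, count-neutral.

WHAT THIS IS FOR.  px12 g11's explicit stratum-(c) family (LOCATE v2.1 `8aced68d`) `U_s(x, μ) = exp(i·s·θ(x_μ mod L)·σ_μ)` has, by block-periodicity, the plaquette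
variables `U_s(∂p) = e_μ(a)·e_ν(b)·e_μ(a)⁻¹·e_ν(b)⁻¹` (`a = sθ(x_μ)`, `b = sθ(x_ν)`), the GROUP COMMUTATOR of two one-axis exponentials
`e_μ(t) := exp(i·t·σ_μ)` about DIFFERENT axes.  This file supplies the two facts the lattice pieces (N3: `U_s ∈ RegPr ρ` for `s² ≲ ρη³`; N5:
irreducibility) read off that commutator: the SIZE bound `‖U_s(∂p) − 1‖ ≤ 2|a||b| = O(s²)` (L²-operator norm = the tree's `dist1` on `SU(2)`) and the
NON-TRIVIALITY `U_s(∂p) ≠ 1` wherever `sin a · sin b ≠ 0` (the family is genuinely curved).  `e_μ(t)` is spelled out everywhere as the literal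
`NormedSpace.exp (Complex.I • ((t : ℂ) • spinHalfPauli μ))` (= the matrix of ✓`Prop7TPrintDefs.expHerm ((t : ℂ) • spinHalfPauli μ)` by `coe_expHerm`; no `def`,
no notation).  The closed form `e_μ(t) = cos t • 1 + (i sin t) • σ_μ` (★`exp_I_smul_pauli`), the SHARP link bound `‖e_μ(t) − 1‖ ≤ |t|` (★`norm_exp_I_smul_pauli_sub_one_le`) and the
`expHerm` dictionary (`coe_expHerm_smul_pauli`) are piece (N2a) (px6 g11, ✓`UnitScaleTiltProp7HPcolNegPauliExp`), and `σ_μ² = 1` is lit ✓`Z2GaugeHiggs.spinHalfPauli_mul_self` — all cited BY NAME, not restated.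

WHAT IS PROVED (ns `Summit.QuantumFields.YangMills.Theorems.Prop7HPcolNegPauliCommutator`).
* §1 Pauli letters: `spinHalfPauli_mul_spinHalfPauli_of_ne` (anticommutation `σ_μσ_ν = −σ_νσ_μ`, `μ ≠ ν`), `spinHalfPauli_mul_spinHalfPauli_ne_zero`, `star_spinHalfPauli`.
* §2 One-axis glue: `exp_pauli_inv` (`e(t)⁻¹ = e(−t)`, Mathlib `Matrix.exp_neg`), `exp_pauli_mul_inv`∕`exp_pauli_inv_mul`, `star_exp_pauli` (`e(t)^* = e(−t)`),
  `exp_pauli_mem_unitary`, `norm_exp_pauli`∕`norm_exp_pauli_inv` (`= 1`, C⋆-norm of a unitary).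
* §3 The commutator: `groupCommutator_sub_one_eq` (`ABA⁻¹B⁻¹ − 1 = (AB − BA)A⁻¹B⁻¹`), `norm_commutator_le` (`‖AB − BA‖ ≤ 2‖A−1‖‖B−1‖`),
  ★★`norm_groupCommutator_exp_pauli_sub_one_le : ‖e_μ(a)e_ν(b)e_μ(a)⁻¹e_ν(b)⁻¹ − 1‖ ≤ 2|a||b|` (every `μ ν a b`; also the `e(−a)`∕`e(−b)` form `…_neg` and the
  `star` form `…_star`, which is the matrix of the `SU(2)` plaquette word), `exp_pauli_mul_exp_pauli_sub` (`e_μ(a)e_ν(b) − e_ν(b)e_μ(a) = −2 sin a sin b • σ_μσ_ν`, `μ ≠ ν`),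
  ★★`groupCommutator_exp_pauli_ne_one` (`μ ≠ ν`, `sin a ≠ 0`, `sin b ≠ 0` ⇒ `≠ 1`; also `…_neg`, `…_star`).
* §4 `SU(2)` currency: `coe_expHerm_commutator` (over (N2a)'s `coe_expHerm_smul_pauli`),
  ★★`dist1_expHerm_commutator_le : dist1 (g_μ(a)g_ν(b)g_μ(a)⁻¹g_ν(b)⁻¹) ≤ 2|a||b|` and ★★`expHerm_commutator_ne_one` for the links `g_μ(t) := expHerm (t • σ_μ)` of the explicit
  field `expHermField` — the sockets N3c (`RegPr` plaquette clause) and N5 read.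
HONEST SCOPE.  2×2-matrix algebra.  `hPcol` is a DISPLAY BINDER of the EX face S42ᴸ — this serves a `Negative` certificate = knowledge of record for footnote 17v, NOT an
item refutation, NOT a display event, NOT progress on EX; nothing of N3–N6, `hPcol`, EX, the 13 rows, 19200 or any crux∕rung is proved here; YM gap NOT proved.

References: T. Bałaban, CMP **102** (1985) 277–309 [Balaban1985Variational] ((2) p.278: the regular space's plaquette clause `|U(∂p) − 1| < ε₀L^{−2(K−n)}`);
CMP **99** (1985) 75–102 [Balaban1985RegularSpaces] ((1.7) p.77).
-/

set_option autoImplicit false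

open scoped Matrix.Norms.L2Operator
open Literature.MathematicalPhysics.QuantumLattice (spinHalfPauli)
open Literature.MathematicalPhysics.QuantumFieldTheory.Balaban1983to89 (dist1)
open Summit.QuantumFields.YangMills.Theorems.Prop7TPrint (expHerm)
open Literature.MathematicalPhysics.QuantumLattice.Z2GaugeHiggs (spinHalfPauli_mul_self)
open Summit.QuantumFields.YangMills.Theorems.Prop7HPcolNegPauliExp (exp_I_smul_pauli norm_exp_I_smul_pauli_sub_one_le coe_expHerm_smul_pauli)

namespace Summit.QuantumFields.YangMills.Theorems.Prop7HPcolNegPauliCommutator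

/-! ## §1 Pauli letters -/

/-- **Anticommutation of distinct Pauli matrices**: `σ_μ σ_ν = −σ_ν σ_μ` for `μ ≠ ν` (entrywise over lit `QuantumLattice.spinHalfPauli`). [folklore] -/
theorem spinHalfPauli_mul_spinHalfPauli_of_ne {μ ν : Fin 3} (h : μ ≠ ν) :
    spinHalfPauli μ * spinHalfPauli ν = -(spinHalfPauli ν * spinHalfPauli μ) := by
  fin_cases μ <;> fin_cases ν <;>
    first | exact absurd rfl h | (ext i j; fin_cases i <;> fin_cases j <;> simp [spinHalfPauli])

/-- A product of two Pauli matrices is non-zero (indeed invertible: `(σ_μσ_ν)(σ_νσ_μ) = 1` by `σ² = 1`). [folklore] -/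
theorem spinHalfPauli_mul_spinHalfPauli_ne_zero (μ ν : Fin 3) : spinHalfPauli μ * spinHalfPauli ν ≠ 0 := by
  intro h
  have h1 : spinHalfPauli μ * spinHalfPauli ν * (spinHalfPauli ν * spinHalfPauli μ) = 1 := by
    rw [Matrix.mul_assoc, ← Matrix.mul_assoc (spinHalfPauli ν), spinHalfPauli_mul_self, Matrix.one_mul, spinHalfPauli_mul_self]
  rw [h, Matrix.zero_mul] at h1
  exact zero_ne_one h1

/-- The Pauli matrices are Hermitian: `σ_μ^* = σ_μ`. [folklore] -/
theorem star_spinHalfPauli (μ : Fin 3) : star (spinHalfPauli μ) = spinHalfPauli μ := by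
  fin_cases μ <;> (ext i j; fin_cases i <;> fin_cases j <;> simp [spinHalfPauli, Matrix.star_apply])

/-! ## §2 The one-axis exponentials `e_μ(t) = exp(i t σ_μ)`: inverse, adjoint, unitarity, norms -/

/-- `e_μ(a)⁻¹ = e_μ(−a)` (matrix inverse; Mathlib `Matrix.exp_neg`). [folklore] -/
theorem exp_pauli_inv (μ : Fin 3) (a : ℝ) :
    (NormedSpace.exp (Complex.I • ((a : ℂ) • spinHalfPauli μ)))⁻¹
      = NormedSpace.exp (Complex.I • (((-a : ℝ) : ℂ) • spinHalfPauli μ)) := by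
  rw [← Matrix.exp_neg]
  congr 1
  push_cast
  simp [smul_neg, neg_smul]

/-- `e_μ(a) · e_μ(a)⁻¹ = 1` (`exp` is a unit). [folklore] -/
theorem exp_pauli_mul_inv (μ : Fin 3) (a : ℝ) :
    NormedSpace.exp (Complex.I • ((a : ℂ) • spinHalfPauli μ)) * (NormedSpace.exp (Complex.I • ((a : ℂ) • spinHalfPauli μ)))⁻¹ = 1 :=
  Matrix.mul_nonsing_inv _ ((Matrix.isUnit_iff_isUnit_det _).mp (Matrix.isUnit_exp _))

/-- `e_μ(a)⁻¹ · e_μ(a) = 1` (`exp` is a unit). [folklore] -/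
theorem exp_pauli_inv_mul (μ : Fin 3) (a : ℝ) :
    (NormedSpace.exp (Complex.I • ((a : ℂ) • spinHalfPauli μ)))⁻¹ * NormedSpace.exp (Complex.I • ((a : ℂ) • spinHalfPauli μ)) = 1 :=
  Matrix.nonsing_inv_mul _ ((Matrix.isUnit_iff_isUnit_det _).mp (Matrix.isUnit_exp _))

/-- **Adjoint**: `e_μ(a)^* = e_μ(−a)` (closed form of (N2a), `σ_μ` Hermitian, `a` real). [folklore] -/
theorem star_exp_pauli (μ : Fin 3) (a : ℝ) :
    star (NormedSpace.exp (Complex.I • ((a : ℂ) • spinHalfPauli μ)))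
      = NormedSpace.exp (Complex.I • (((-a : ℝ) : ℂ) • spinHalfPauli μ)) := by
  rw [exp_I_smul_pauli, exp_I_smul_pauli, Real.cos_neg, Real.sin_neg, Complex.ofReal_neg, star_add, star_smul, star_smul,
    star_one, star_spinHalfPauli, Complex.star_def, Complex.conj_ofReal, map_mul, Complex.conj_I, Complex.conj_ofReal,
    mul_neg, neg_mul]

/-- **Unitarity**: `e_μ(a) ∈ U(2)` (as an element of the unitary submonoid of `M₂(ℂ)`). [folklore] -/
theorem exp_pauli_mem_unitary (μ : Fin 3) (a : ℝ) :
    NormedSpace.exp (Complex.I • ((a : ℂ) • spinHalfPauli μ)) ∈ unitary (Matrix (Fin 2) (Fin 2) ℂ) := by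
  rw [Unitary.mem_iff, star_exp_pauli, ← exp_pauli_inv]
  exact ⟨exp_pauli_inv_mul μ a, exp_pauli_mul_inv μ a⟩

/-- `‖e_μ(a)‖ = 1` in the L²-operator norm (a unitary in the C⋆-algebra `M₂(ℂ)`). [folklore] -/
theorem norm_exp_pauli (μ : Fin 3) (a : ℝ) : ‖NormedSpace.exp (Complex.I • ((a : ℂ) • spinHalfPauli μ))‖ = 1 :=
  CStarRing.norm_of_mem_unitary (exp_pauli_mem_unitary μ a)

/-- `‖e_μ(a)⁻¹‖ = 1`. [folklore] -/
theorem norm_exp_pauli_inv (μ : Fin 3) (a : ℝ) : ‖(NormedSpace.exp (Complex.I • ((a : ℂ) • spinHalfPauli μ)))⁻¹‖ = 1 := by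
  rw [exp_pauli_inv]; exact norm_exp_pauli μ (-a)

/-! ## §3 The group commutator of two one-axis exponentials -/

/-- `ABA⁻¹B⁻¹ − 1 = (AB − BA)·A⁻¹B⁻¹` whenever `AA⁻¹ = BB⁻¹ = 1`. [folklore] -/
theorem groupCommutator_sub_one_eq (A B : Matrix (Fin 2) (Fin 2) ℂ) (hA : A * A⁻¹ = 1) (hB : B * B⁻¹ = 1) :
    A * B * A⁻¹ * B⁻¹ - 1 = (A * B - B * A) * (A⁻¹ * B⁻¹) := by
  have : B * A * (A⁻¹ * B⁻¹) = 1 := by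
    rw [Matrix.mul_assoc, ← Matrix.mul_assoc A, hA, Matrix.one_mul, hB]
  rw [sub_mul, this]
  simp only [Matrix.mul_assoc]

/-- `AB − BA = (A−1)(B−1) − (B−1)(A−1)`. [folklore] -/
theorem commutator_eq_sub_one_commutator (A B : Matrix (Fin 2) (Fin 2) ℂ) :
    A * B - B * A = (A - 1) * (B - 1) - (B - 1) * (A - 1) := by
  noncomm_ring

/-- `‖AB − BA‖ ≤ 2‖A − 1‖‖B − 1‖`. [folklore] -/
theorem norm_commutator_le (A B : Matrix (Fin 2) (Fin 2) ℂ) : ‖A * B - B * A‖ ≤ 2 * ‖A - 1‖ * ‖B - 1‖ := by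
  rw [commutator_eq_sub_one_commutator]
  calc ‖(A - 1) * (B - 1) - (B - 1) * (A - 1)‖ ≤ ‖(A - 1) * (B - 1)‖ + ‖(B - 1) * (A - 1)‖ := norm_sub_le _ _
    _ ≤ ‖A - 1‖ * ‖B - 1‖ + ‖B - 1‖ * ‖A - 1‖ := add_le_add (norm_mul_le _ _) (norm_mul_le _ _)
    _ = 2 * ‖A - 1‖ * ‖B - 1‖ := by ring

/-- ★★ **THE COMMUTATOR PLAQUETTE IS `O(|a||b|)`-CLOSE TO `1`**: `‖e_μ(a)·e_ν(b)·e_μ(a)⁻¹·e_ν(b)⁻¹ − 1‖ ≤ 2|a||b|` for all axes `μ, ν` and all real `a, b`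
(L²-operator norm = `dist1` on `SU(2)`).  With `a, b = O(s)` this is the `O(s²)` plaquette clause of the explicit stratum-(c) family in `RegPr ρ`
([Balaban1985Variational] (2): `|U(∂p) − 1| < ε₀L^{−2(K−n)}`). [folklore] -/
theorem norm_groupCommutator_exp_pauli_sub_one_le (μ ν : Fin 3) (a b : ℝ) :
    ‖NormedSpace.exp (Complex.I • ((a : ℂ) • spinHalfPauli μ)) * NormedSpace.exp (Complex.I • ((b : ℂ) • spinHalfPauli ν))
        * (NormedSpace.exp (Complex.I • ((a : ℂ) • spinHalfPauli μ)))⁻¹ * (NormedSpace.exp (Complex.I • ((b : ℂ) • spinHalfPauli ν)))⁻¹ - 1‖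
      ≤ 2 * |a| * |b| := by
  set A := NormedSpace.exp (Complex.I • ((a : ℂ) • spinHalfPauli μ)) with hA
  set B := NormedSpace.exp (Complex.I • ((b : ℂ) • spinHalfPauli ν)) with hB
  rw [groupCommutator_sub_one_eq A B (exp_pauli_mul_inv μ a) (exp_pauli_mul_inv ν b)]
  calc ‖(A * B - B * A) * (A⁻¹ * B⁻¹)‖ ≤ ‖A * B - B * A‖ * ‖A⁻¹ * B⁻¹‖ := norm_mul_le _ _
    _ ≤ (2 * ‖A - 1‖ * ‖B - 1‖) * (‖A⁻¹‖ * ‖B⁻¹‖) :=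
        mul_le_mul (norm_commutator_le A B) (norm_mul_le _ _) (norm_nonneg _) (by positivity)
    _ = 2 * ‖A - 1‖ * ‖B - 1‖ := by rw [hA, hB, norm_exp_pauli_inv, norm_exp_pauli_inv]; ring
    _ ≤ 2 * |a| * |b| := by
        gcongr
        · exact norm_exp_I_smul_pauli_sub_one_le μ a
        · exact norm_exp_I_smul_pauli_sub_one_le ν b

/-- ★★ The same bound with the inverses written as `e_μ(−a)`, `e_ν(−b)`. [folklore] -/
theorem norm_groupCommutator_exp_pauli_sub_one_le_neg (μ ν : Fin 3) (a b : ℝ) :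
    ‖NormedSpace.exp (Complex.I • ((a : ℂ) • spinHalfPauli μ)) * NormedSpace.exp (Complex.I • ((b : ℂ) • spinHalfPauli ν))
        * NormedSpace.exp (Complex.I • (((-a : ℝ) : ℂ) • spinHalfPauli μ)) * NormedSpace.exp (Complex.I • (((-b : ℝ) : ℂ) • spinHalfPauli ν)) - 1‖
      ≤ 2 * |a| * |b| := by
  rw [← exp_pauli_inv, ← exp_pauli_inv]; exact norm_groupCommutator_exp_pauli_sub_one_le μ ν a b

/-- ★★ The same bound with the inverses written as adjoints `e_μ(a)^*`, `e_ν(b)^*` — the matrix of the `SU(2)` plaquette word `U₁U₂U₁⁻¹U₂⁻¹`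
(`↑(g⁻¹) = star ↑g` in `Matrix.specialUnitaryGroup`). [folklore] -/
theorem norm_groupCommutator_exp_pauli_sub_one_le_star (μ ν : Fin 3) (a b : ℝ) :
    ‖NormedSpace.exp (Complex.I • ((a : ℂ) • spinHalfPauli μ)) * NormedSpace.exp (Complex.I • ((b : ℂ) • spinHalfPauli ν))
        * star (NormedSpace.exp (Complex.I • ((a : ℂ) • spinHalfPauli μ))) * star (NormedSpace.exp (Complex.I • ((b : ℂ) • spinHalfPauli ν))) - 1‖
      ≤ 2 * |a| * |b| := by
  rw [star_exp_pauli, star_exp_pauli]; exact norm_groupCommutator_exp_pauli_sub_one_le_neg μ ν a b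

/-- **The ring commutator in closed form**: `e_μ(a)e_ν(b) − e_ν(b)e_μ(a) = −2 sin a sin b • σ_μσ_ν` for `μ ≠ ν` (the cross terms are the COMMUTATOR
`[σ_μ, σ_ν] = 2σ_μσ_ν` of anticommuting Pauli matrices). [folklore] -/
theorem exp_pauli_mul_exp_pauli_sub {μ ν : Fin 3} (hμν : μ ≠ ν) (a b : ℝ) :
    NormedSpace.exp (Complex.I • ((a : ℂ) • spinHalfPauli μ)) * NormedSpace.exp (Complex.I • ((b : ℂ) • spinHalfPauli ν))
      - NormedSpace.exp (Complex.I • ((b : ℂ) • spinHalfPauli ν)) * NormedSpace.exp (Complex.I • ((a : ℂ) • spinHalfPauli μ))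
      = (-(2 * Real.sin a * Real.sin b : ℝ) : ℂ) • (spinHalfPauli μ * spinHalfPauli ν) := by
  rw [exp_I_smul_pauli, exp_I_smul_pauli]
  push_cast
  simp only [add_mul, mul_add, Matrix.smul_mul, Matrix.mul_smul, Matrix.one_mul, Matrix.mul_one, smul_smul]
  rw [spinHalfPauli_mul_spinHalfPauli_of_ne (Ne.symm hμν), smul_neg]
  have hI : Complex.I * Complex.sin ↑a * (Complex.I * Complex.sin ↑b) = -(Complex.sin ↑a * Complex.sin ↑b) := by
    rw [mul_mul_mul_comm, Complex.I_mul_I]; ring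
  have hI' : Complex.I * Complex.sin ↑b * (Complex.I * Complex.sin ↑a) = -(Complex.sin ↑a * Complex.sin ↑b) := by
    rw [mul_mul_mul_comm, Complex.I_mul_I]; ring
  rw [hI, hI']
  module

/-- ★★ **THE COMMUTATOR PLAQUETTE IS NOT TRIVIAL**: for distinct axes `μ ≠ ν` and angles with `sin a ≠ 0`, `sin b ≠ 0`,
`e_μ(a)·e_ν(b)·e_μ(a)⁻¹·e_ν(b)⁻¹ ≠ 1` — the explicit family is genuinely curved (its plaquette holonomy is a non-trivial rotation about the third axis). [folklore] -/
theorem groupCommutator_exp_pauli_ne_one {μ ν : Fin 3} (hμν : μ ≠ ν) {a b : ℝ} (ha : Real.sin a ≠ 0) (hb : Real.sin b ≠ 0) :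
    NormedSpace.exp (Complex.I • ((a : ℂ) • spinHalfPauli μ)) * NormedSpace.exp (Complex.I • ((b : ℂ) • spinHalfPauli ν))
        * (NormedSpace.exp (Complex.I • ((a : ℂ) • spinHalfPauli μ)))⁻¹ * (NormedSpace.exp (Complex.I • ((b : ℂ) • spinHalfPauli ν)))⁻¹ ≠ 1 := by
  set A := NormedSpace.exp (Complex.I • ((a : ℂ) • spinHalfPauli μ)) with hA
  set B := NormedSpace.exp (Complex.I • ((b : ℂ) • spinHalfPauli ν)) with hB
  intro h
  have hAi : A⁻¹ * A = 1 := exp_pauli_inv_mul μ a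
  have hBi : B⁻¹ * B = 1 := exp_pauli_inv_mul ν b
  have h1 : A * B * A⁻¹ = B := by
    calc A * B * A⁻¹ = A * B * A⁻¹ * (B⁻¹ * B) := by rw [hBi, Matrix.mul_one]
      _ = (A * B * A⁻¹ * B⁻¹) * B := by simp only [Matrix.mul_assoc]
      _ = B := by rw [h, Matrix.one_mul]
  have hAB : A * B = B * A := by
    calc A * B = A * B * (A⁻¹ * A) := by rw [hAi, Matrix.mul_one]
      _ = (A * B * A⁻¹) * A := by simp only [Matrix.mul_assoc]
      _ = B * A := by rw [h1]
  have hsub := exp_pauli_mul_exp_pauli_sub hμν a b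
  rw [← hA, ← hB, hAB, sub_self] at hsub
  have hc : (-(2 * Real.sin a * Real.sin b : ℝ) : ℂ) ≠ 0 := by
    exact_mod_cast neg_ne_zero.mpr (mul_ne_zero (mul_ne_zero two_ne_zero ha) hb)
  exact spinHalfPauli_mul_spinHalfPauli_ne_zero μ ν ((smul_eq_zero.mp hsub.symm).resolve_left hc)

/-- ★★ The same with the inverses written as `e_μ(−a)`, `e_ν(−b)`. [folklore] -/
theorem groupCommutator_exp_pauli_ne_one_neg {μ ν : Fin 3} (hμν : μ ≠ ν) {a b : ℝ} (ha : Real.sin a ≠ 0) (hb : Real.sin b ≠ 0) :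
    NormedSpace.exp (Complex.I • ((a : ℂ) • spinHalfPauli μ)) * NormedSpace.exp (Complex.I • ((b : ℂ) • spinHalfPauli ν))
        * NormedSpace.exp (Complex.I • (((-a : ℝ) : ℂ) • spinHalfPauli μ)) * NormedSpace.exp (Complex.I • (((-b : ℝ) : ℂ) • spinHalfPauli ν)) ≠ 1 := by
  rw [← exp_pauli_inv, ← exp_pauli_inv]; exact groupCommutator_exp_pauli_ne_one hμν ha hb

/-- ★★ The same with the inverses written as adjoints (the matrix of the `SU(2)` plaquette word). [folklore] -/
theorem groupCommutator_exp_pauli_ne_one_star {μ ν : Fin 3} (hμν : μ ≠ ν) {a b : ℝ} (ha : Real.sin a ≠ 0) (hb : Real.sin b ≠ 0) :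
    NormedSpace.exp (Complex.I • ((a : ℂ) • spinHalfPauli μ)) * NormedSpace.exp (Complex.I • ((b : ℂ) • spinHalfPauli ν))
        * star (NormedSpace.exp (Complex.I • ((a : ℂ) • spinHalfPauli μ))) * star (NormedSpace.exp (Complex.I • ((b : ℂ) • spinHalfPauli ν))) ≠ 1 := by
  rw [star_exp_pauli, star_exp_pauli]; exact groupCommutator_exp_pauli_ne_one_neg hμν ha hb

/-! ## §4 The same two facts in `SU(2)` currency: the plaquette word of ✓`Prop7TPrintDefs.expHerm` links and the tree's `dist1` -/

/-- The matrix of the `SU(2)` plaquette word `g_μ(a)·g_ν(b)·g_μ(a)⁻¹·g_ν(b)⁻¹` of the links `g_μ(t) := expHerm (t • σ_μ)` is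
`e_μ(a)·e_ν(b)·e_μ(a)^*·e_ν(b)^*` (`↑g⁻¹ = star ↑g`, ✓`coe_expHerm`). [folklore] -/
theorem coe_expHerm_commutator (μ ν : Fin 3) (a b : ℝ) :
    ((expHerm ((a : ℂ) • spinHalfPauli μ) * expHerm ((b : ℂ) • spinHalfPauli ν) * (expHerm ((a : ℂ) • spinHalfPauli μ))⁻¹
        * (expHerm ((b : ℂ) • spinHalfPauli ν))⁻¹ : Matrix.specialUnitaryGroup (Fin 2) ℂ) : Matrix (Fin 2) (Fin 2) ℂ)
      = NormedSpace.exp (Complex.I • ((a : ℂ) • spinHalfPauli μ)) * NormedSpace.exp (Complex.I • ((b : ℂ) • spinHalfPauli ν))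
        * star (NormedSpace.exp (Complex.I • ((a : ℂ) • spinHalfPauli μ))) * star (NormedSpace.exp (Complex.I • ((b : ℂ) • spinHalfPauli ν))) := by
  rw [Submonoid.coe_mul, Submonoid.coe_mul, Submonoid.coe_mul, ← Matrix.star_eq_inv, ← Matrix.star_eq_inv,
    Matrix.specialUnitaryGroup.coe_star, Matrix.specialUnitaryGroup.coe_star,
    coe_expHerm_smul_pauli, coe_expHerm_smul_pauli]

/-- ★★ **`dist1` OF THE COMMUTATOR PLAQUETTE ≤ 2|a||b|** — the plaquette clause `|U(∂p) − 1| < ε₀L^{−2(K−n)}` of `RegPr` ([Balaban1985Variational] (2) p.278) for the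
explicit family, in the tree's own currency (`dist1` on `Matrix.specialUnitaryGroup (Fin 2) ℂ` = L²-operator norm of `↑g − 1`, `UnitaryModel`). [folklore] -/
theorem dist1_expHerm_commutator_le (μ ν : Fin 3) (a b : ℝ) :
    dist1 (expHerm ((a : ℂ) • spinHalfPauli μ) * expHerm ((b : ℂ) • spinHalfPauli ν) * (expHerm ((a : ℂ) • spinHalfPauli μ))⁻¹
        * (expHerm ((b : ℂ) • spinHalfPauli ν))⁻¹) ≤ 2 * |a| * |b| := by
  change ‖((expHerm ((a : ℂ) • spinHalfPauli μ) * expHerm ((b : ℂ) • spinHalfPauli ν) * (expHerm ((a : ℂ) • spinHalfPauli μ))⁻¹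
        * (expHerm ((b : ℂ) • spinHalfPauli ν))⁻¹ : Matrix.specialUnitaryGroup (Fin 2) ℂ) : Matrix (Fin 2) (Fin 2) ℂ) - 1‖ ≤ 2 * |a| * |b|
  rw [coe_expHerm_commutator]
  exact norm_groupCommutator_exp_pauli_sub_one_le_star μ ν a b

/-- ★★ **THE COMMUTATOR PLAQUETTE IN `SU(2)` IS NOT `1`** for distinct axes and `sin a, sin b ≠ 0` (the explicit family is curved). [folklore] -/
theorem expHerm_commutator_ne_one {μ ν : Fin 3} (hμν : μ ≠ ν) {a b : ℝ} (ha : Real.sin a ≠ 0) (hb : Real.sin b ≠ 0) :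
    expHerm ((a : ℂ) • spinHalfPauli μ) * expHerm ((b : ℂ) • spinHalfPauli ν) * (expHerm ((a : ℂ) • spinHalfPauli μ))⁻¹
        * (expHerm ((b : ℂ) • spinHalfPauli ν))⁻¹ ≠ 1 := by
  intro h
  have h' := congrArg (fun g : Matrix.specialUnitaryGroup (Fin 2) ℂ => (g : Matrix (Fin 2) (Fin 2) ℂ)) h
  rw [coe_expHerm_commutator, Submonoid.coe_one] at h'
  exact groupCommutator_exp_pauli_ne_one_star hμν ha hb h'

end Summit.QuantumFields.YangMills.Theorems.Prop7HPcolNegPauliCommutator
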